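import Mathlib
import HarnessLib
import Summits.HubbardSuperconductivity.HubbardSuperconductivity.Theorems.KLProgrammeKLRegimeBetaSplitSlotsV7S
import Summits.HubbardSuperconductivity.HubbardSuperconductivity.Theorems.KLProgrammeKLRegimeSplitBundleV10

/-!
# Route `KLProgramme` — crux K3 gen 3, child 1 `KLRegimeBetaSplitV10 := BetaSplitP klPredsV10 klWindowC` CLOSED: `betaSplitP_klPredsV10 (W)`

Cell gate-hubbard-kl, seat hubbard-kl-k3c1-p2 (child-1 re-closure owner on gen 3, plan g10 17:05Z (4); bundle V10 = V9 + Δ19/Δ-UV, director 18:08Z,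
typist k3c2-p3).  `klPredsV10` has the split slot `BetaSplitAtS2` (unchanged since V7) and the engine slot `EngineBoundsAtV7S` (V6S with the two
scale-`0` value clauses widened by the count-free leg term `legDressBarQ G P Q U 0 4`), the only slots child 1 reads: **`betaSplitP_klPredsV10`** is
`betaSplitP_of_slotsV7S` (`…KLRegimeBetaSplitSlotsV7S`) with the two identity slot maps.  One line; nothing new.
-/

noncomputable section

namespace Summit.HubbardSuperconductivity.HubbardSuperconductivity.Theorems.KLRegimeSplit

set_option linter.dupNamespace false -- summit = problem name (single-conjunct summit), D-0017

/-- **Child 1 at the V10 bundle, every covariance window** (in particular `klWindowC`: the gen-3 route item `KLRegimeBetaSplitV10`). -/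
theorem betaSplitP_klPredsV10 (W : Set ℝ) : BetaSplitP klPredsV10 W :=
  betaSplitP_of_slotsV7S (Pr := klPredsV10) (fun _ _ _ _ _ _ _ _ _ _ _ _ h => h) (fun _ _ _ _ _ _ _ _ _ _ _ _ h => h)

end Summit.HubbardSuperconductivity.HubbardSuperconductivity.Theorems.KLRegimeSplit

end
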